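import Mathlib
import HarnessLib
import Summits.HubbardSuperconductivity.HubbardSuperconductivity.Theorems.KLProgrammeKLRegimeEngineFrameShiftDressingSupFlowMainAliasPosPure
import Summits.HubbardSuperconductivity.HubbardSuperconductivity.Theorems.KLProgrammeKLRegimeEngineGeneralStepResponseFitArithPure
import Summits.HubbardSuperconductivity.HubbardSuperconductivity.Theorems.KLProgrammeKLRegimeFlowReadResponseFit
import Summits.HubbardSuperconductivity.HubbardSuperconductivity.Theorems.KLProgrammeKLRegimeEngineIsoTupleV17FDoor

/-!
# K3 gen-8-FLOW (stmt 20437, stub (C), located «(B)-MAIN-UNPRIMED», cure «(B)-MAIN-PURE»): «(B)-FIT» at the GENERAL STEP in ONE CALL from the PURE-moment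
# door — `frameResponse_hB_flow_of_pos_pure` (cell gate-hubbard-kl, seat p2 g22)

Twin of `…GeneralStepResponseFitOfPos.frameResponse_hB_flow_of_pos` (p652037) built on the PURE-moment general-step door
`…MainAliasPosPure.…_main_add_alias_pos_pure` and the arithmetic `…ResponseFitArithPure.generalRHS_le_fit_pure`.  WHY (KL STATUS 2026-08-28, p2 g22
«(B)-MAIN-UNPRIMED»): k3c3-p1's (B)-FIT (p596448) books the derivative rows `l = 1…4` of the frame response in the UNPRIMED curve-jet column (`readJetC μc ·`
against `klC4aJetC2 = 2^10/2^4/2^4/2^11`), and with the `(1+|Δx̃|)ˡ`-weighted tower input those rows are `O(U²)` with coefficient `≥ 2^{32−2l}·Gfr₀/4!` — not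
bookable.  With the PURE weight `(|Δx̃₀|+|Δx̃₁|)ˡ` the bare local vertex (whose tadpole response is k-independent, hence killed by `Dˡ`) drops from the tower
input at orders `l ≥ 1`, its natural law becomes `cN_l·U²·(4^m)ˡ`, and every row of order `l ≥ 1` is `≤ X_l·U·(U²·4^{(l−2)(m+1)})` — `|U|`-SUPPRESSED.  E1 side
(β-free constants): `cN 0` (`ε³Σ_{x: x0=x₀}‖W₄[𝒢_t]‖ ≤ cN 0·U`, weight `(…)⁰ = 1`), `cN l` (`1 ≤ l ≤ 4`: `ε³Σ (|Δx̃₀|+|Δx̃₁|)ˡ‖W₄[𝒢_t]‖ ≤ cN l·U²·(4^m)ˡ`), and as in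
p652037 `cS l`/`cSs`, `cE l`/`cEs` (two-leg rows, submultiplicative weight unchanged).  BUDGET WORD: any table `μc ≥ 0` (it may depend on
`U`) with `X_0 ≤ μc 0` and `U·X_l ≤ μc l` (`1 ≤ l ≤ 4`), `X_l = 2^32/4ˡ·Gfr₀·cN l + (Rsq⁴(cS l²+cE l+1) + (cSs²+cEs+1))/2^200`; the closer may take
`μc l := U·X_l` (then `eB k = readJetC μc k` is `|U|`·(scale-free), i.e. the unprimed fit `cA k + eB k + … ≤ cc k` becomes a U-threshold) — the value row
`l = 0` is booked primed by the (B)-FIT itself (`eB′ 0 = μc 0` vs `klC4aJetC′ P R 0 = 2^80·Psq²Rsq²`).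
OUTPUT = the LITERAL `(hBdiff, hB)` pair of `twoLegReadPriv_flow_succ` (p598604) at scale `m` (`m + 1 ≤ n_β`), tables `eB = (0, readJetC μc ·)`,
`eB′ = (μc 0, readJetC′ R μc ·)`.

* **`frameResponse_hB_flow_of_pos_pure`**.

Composition only; no definitions; nothing asserts any stub of 20437, K3, the margin or superconductivity.  References: BGM 2006 §2.3 (2.21)–(2.24), §2.4
Lemma 2.1 (2.36)–(2.42) [cite: BenfattoGiulianiMastropietro2006]; FST 1996 §1 [cite: FeldmanSalmhoferTrubowitz1996].
-/


noncomputable section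

namespace Summit.HubbardSuperconductivity.HubbardSuperconductivity.Theorems.EngineV8

set_option linter.dupNamespace false -- summit = problem name (single-conjunct summit), D-0017
set_option exponentiation.threshold 1024 -- `2^200`, `2^218` literals in the arithmetic word

open Complex Real Finset Filter Literature.MathematicalPhysics.QuantumLattice Literature.Probability.LatticeModels GrassmannAlgebra
open Literature.MathematicalPhysics.QuantumLattice.BandSectorCounting
open Summit.HubbardSuperconductivity.HubbardSuperconductivity.Theorems.KLRegimeSplit
open Summit.HubbardSuperconductivity.HubbardSuperconductivity.Theorems.DispersionFlow
open Summit.HubbardSuperconductivity.HubbardSuperconductivity.Theorems.KLProgrammeLegKernels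
open Summit.HubbardSuperconductivity.HubbardSuperconductivity.Theorems.PerturbedFermiCurve
open scoped Nat

section GeneralOfPosPure

variable {L M : ℕ} [NeZero L] [NeZero M]

/-- **«(B)-FIT» AT THE GENERAL STEP FROM THE PURE-MOMENT POSITION-SPACE DOOR, ONE CALL** — see the module docstring.
[cite: BenfattoGiulianiMastropietro2006, §2.4 Lemma 2.1 (2.36)–(2.42)] -/
theorem frameResponse_hB_flow_of_pos_pure {R : RenConsts} (hR : ∀ j, 0 ≤ R.Gfr j) {c : ℝ} (hc : 0 < c) (hcle : c ≤ klCurveC3 R)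
    {U : ℝ} (hU : 0 < U) (hU1 : U ≤ 1) (hUle : U ≤ klCurveU0 R) {β : ℝ} (hβmin : klBetaMin ≤ β) (hβc : β ≤ Real.exp (c / U ^ 2))
    {μ : ℝ} (hμ : μ ∈ klWindowC) (m : ℕ) (hm1 : m + 1 ≤ nScales β)
    {G : GeoConsts} {Q : EngConsts} (hGS : ∀ k, 0 ≤ G.S k) (hQS : ∀ k, 0 ≤ Q.S' k)
    {Nf₁ N : ℕ} (hOK₁ : FrameOK R U Nf₁ μ (klFlowFrameU L M β U μ m)) (hOK₂ : FrameOK R U N μ (klFlowFrameU L M β U μ (m + 1))) (hNn : N ≤ m + 1)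
    (hZ₂ : IsUnit (effPartitionFn ℂ (normalCovariance L M (uvSymbolCT L M β μ (klFlowFrameU L M β U μ (m + 1)) (klScale klE0 m))) (hubbardInteraction L M β U + counterQuadratic L M β (klFlowFrameU L M β U μ (m + 1)))))
    (hZ : ∀ t ∈ Set.Icc (0 : ℝ) 1, effPartitionFn ℂ
      (normalCovariance L M (uvSymbolCT L M β μ (klFlowFrameU L M β U μ m) (klScale klE0 m)) + ((t : ℂ)) • (normalCovariance L M (fun ks => uvSymbolCT L M β μ (klFlowFrameU L M β U μ (m + 1)) (klScale klE0 m) ks / (1 + uvSymbolCT L M β μ (klFlowFrameU L M β U μ (m + 1)) (klScale klE0 m) ks * (((fsub (klFlowFrameU L M β U μ (m + 1)) (klFlowFrameU L M β U μ m)).eval (latticeMomentum L ks.1.2) / (β * (L : ℝ) ^ 2) : ℝ) : ℂ))) - normalCovariance L M (uvSymbolCT L M β μ (klFlowFrameU L M β U μ m) (klScale klE0 m)))) (hubbardInteraction L M β U + counterQuadratic L M β (klFlowFrameU L M β U μ m)) ≠ 0)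
    -- the flow history and the closed envelopes (verbatim from the door)
    {n : ℕ} (hP : ∀ m' ≤ n, FlowPieceJetsAt L M β U μ R m') (hTJ : ∀ m' ≤ n, TwoLegReadJetsF L M G Q β U μ m') (hmn : m ≤ n)
    (hR0 : 0 < R.Gfr 0) {W Ξ Θ : ℝ} (hW : W = curveExtC (8 * 576 * (342 : ℝ) ^ 4) G.S 1 + curveExtC (8 * 576 * (342 : ℝ) ^ 4) Q.S' 1 * |U|)
    (hΞ : Ξ = (2 ^ 10 * (1 + Real.pi ^ 8 * (W * U ^ 2) / 2 ^ 11) + ∑ j ∈ range 5, R.Gfr j))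
    (hΘ : Θ = (1 + ((∑ j ∈ range 5, R.Gfr j) + Real.pi ^ 8 * W / 2 ^ 11) * |U| / R.Gfr 0))
    (hdoor : R.Gfr 0 * |U| + ((∑ j ∈ range 5, R.Gfr j) + Real.pi ^ 8 * W / 2 ^ 11) * U ^ 2 ≤ 1 / 128) {P : SplitConsts} (hL : klEngL₄ P R β U ≤ L)
    {s : ℕ} (hs : 30 ≤ s)
    -- E1: β-free graded constant families (four-leg: PURE weight, `U²` law at orders ≥ 1)
    {cN cS cE : ℕ → ℝ} {cSs cEs : ℝ} (hcN : ∀ l, 0 ≤ cN l) (hcS : ∀ l, 0 ≤ cS l) (hcE : ∀ l, 0 ≤ cE l) (hcSs : 0 ≤ cSs) (hcEs : 0 ≤ cEs)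
    (hNp0 : ∀ t ∈ Set.Icc (0 : ℝ) 1, ∀ (σ : Fin 2) (A : HubbardFieldIdx L M) (x₀ : SpaceTimeIdx L M), imagTimeWeight β M ^ 3 *
      ∑ x ∈ (univ : Finset (Fin 4 → SpaceTimeIdx L M)).filter (fun x => x 0 = x₀),
        (((((x 1).2 - (x 0).2) 0).valMinAbs.natAbs : ℝ) + ((((x 1).2 - (x 0).2) 1).valMinAbs.natAbs : ℝ)) ^ 0 *
          ‖sectorisedKernel L M β (trivialMultiplier L M)
            (effAction ℂ (normalCovariance L M (uvSymbolCT L M β μ (klFlowFrameU L M β U μ m) (klScale klE0 m)) + ((t : ℂ)) • (normalCovariance L M (fun ks => uvSymbolCT L M β μ (klFlowFrameU L M β U μ (m + 1)) (klScale klE0 m) ks / (1 + uvSymbolCT L M β μ (klFlowFrameU L M β U μ (m + 1)) (klScale klE0 m) ks * (((fsub (klFlowFrameU L M β U μ (m + 1)) (klFlowFrameU L M β U μ m)).eval (latticeMomentum L ks.1.2) / (β * (L : ℝ) ^ 2) : ℝ) : ℂ))) - normalCovariance L M (uvSymbolCT L M β μ (klFlowFrameU L M β U μ m) (klScale klE0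 m)))) (hubbardInteraction L M β U + counterQuadratic L M β (klFlowFrameU L M β U μ m))) 4
            (![((0, σ), 0), ((0, σ), 1), ((0, A.1.2), 1 - A.2), ((0, A.1.2), A.2)] : Fin 4 → SectorLeg 1) x‖ ≤ cN 0 * U)
    (hNp : ∀ l, 1 ≤ l → l ≤ 4 → ∀ t ∈ Set.Icc (0 : ℝ) 1, ∀ (σ : Fin 2) (A : HubbardFieldIdx L M) (x₀ : SpaceTimeIdx L M), imagTimeWeight β M ^ 3 *
      ∑ x ∈ (univ : Finset (Fin 4 → SpaceTimeIdx L M)).filter (fun x => x 0 = x₀),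
        (((((x 1).2 - (x 0).2) 0).valMinAbs.natAbs : ℝ) + ((((x 1).2 - (x 0).2) 1).valMinAbs.natAbs : ℝ)) ^ l *
          ‖sectorisedKernel L M β (trivialMultiplier L M)
            (effAction ℂ (normalCovariance L M (uvSymbolCT L M β μ (klFlowFrameU L M β U μ m) (klScale klE0 m)) + ((t : ℂ)) • (normalCovariance L M (fun ks => uvSymbolCT L M β μ (klFlowFrameU L M β U μ (m + 1)) (klScale klE0 m) ks / (1 + uvSymbolCT L M β μ (klFlowFrameU L M β U μ (m + 1)) (klScale klE0 m) ks * (((fsub (klFlowFrameU L M β U μ (m + 1)) (klFlowFrameU L M β U μ m)).eval (latticeMomentum L ks.1.2) / (β * (L : ℝ) ^ 2) : ℝ) : ℂ))) - normalCovariance L M (uvSymbolCT L M β μ (klFlowFrameU L M β U μ m) (klScale klE0 m)))) (hubbardInteraction L M β U + counterQuadratic L M β (klFlowFrameU L M β U μ m))) 4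
            (![((0, σ), 0), ((0, σ), 1), ((0, A.1.2), 1 - A.2), ((0, A.1.2), A.2)] : Fin 4 → SectorLeg 1) x‖ ≤ cN l * U ^ 2 * ((4 : ℝ) ^ m) ^ l)
    (hSp : ∀ l ≤ 4, ∀ t ∈ Set.Icc (0 : ℝ) 1, ∀ (σ : Fin 2) (x₀ : SpaceTimeIdx L M),
      (imagTimeWeight β M * ∑ x ∈ (univ : Finset (Fin 2 → SpaceTimeIdx L M)).filter (fun x => x 0 = x₀),
        (1 + ((((x 1).2 - (x 0).2) 0).valMinAbs.natAbs : ℝ) + ((((x 1).2 - (x 0).2) 1).valMinAbs.natAbs : ℝ)) ^ l *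
          ‖sectorisedKernel L M β (trivialMultiplier L M)
            (effAction ℂ (normalCovariance L M (uvSymbolCT L M β μ (klFlowFrameU L M β U μ m) (klScale klE0 m)) + ((t : ℂ)) • (normalCovariance L M (fun ks => uvSymbolCT L M β μ (klFlowFrameU L M β U μ (m + 1)) (klScale klE0 m) ks / (1 + uvSymbolCT L M β μ (klFlowFrameU L M β U μ (m + 1)) (klScale klE0 m) ks * (((fsub (klFlowFrameU L M β U μ (m + 1)) (klFlowFrameU L M β U μ m)).eval (latticeMomentum L ks.1.2) / (β * (L : ℝ) ^ 2) : ℝ) : ℂ))) - normalCovariance L M (uvSymbolCT L M β μ (klFlowFrameU L M β U μ m) (klScale klE0 m)))) (hubbardInteraction L M β U + counterQuadratic L M β (klFlowFrameU L M β U μ m))) 2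
            (![((0, σ), 0), ((0, σ), 1)] : Fin 2 → SectorLeg 1) x‖ ≤ cS l * U * ((4 : ℝ) ^ m) ^ l))
    (hSps : ∀ t ∈ Set.Icc (0 : ℝ) 1, ∀ (σ : Fin 2) (x₀ : SpaceTimeIdx L M),
      (imagTimeWeight β M * ∑ x ∈ (univ : Finset (Fin 2 → SpaceTimeIdx L M)).filter (fun x => x 0 = x₀),
        (1 + ((((x 1).2 - (x 0).2) 0).valMinAbs.natAbs : ℝ) + ((((x 1).2 - (x 0).2) 1).valMinAbs.natAbs : ℝ)) ^ s *
          ‖sectorisedKernel L M β (trivialMultiplier L M)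
            (effAction ℂ (normalCovariance L M (uvSymbolCT L M β μ (klFlowFrameU L M β U μ m) (klScale klE0 m)) + ((t : ℂ)) • (normalCovariance L M (fun ks => uvSymbolCT L M β μ (klFlowFrameU L M β U μ (m + 1)) (klScale klE0 m) ks / (1 + uvSymbolCT L M β μ (klFlowFrameU L M β U μ (m + 1)) (klScale klE0 m) ks * (((fsub (klFlowFrameU L M β U μ (m + 1)) (klFlowFrameU L M β U μ m)).eval (latticeMomentum L ks.1.2) / (β * (L : ℝ) ^ 2) : ℝ) : ℂ))) - normalCovariance L M (uvSymbolCT L M β μ (klFlowFrameU L M β U μ m) (klScale klE0 m)))) (hubbardInteraction L M β U + counterQuadratic L M β (klFlowFrameU L M β U μ m))) 2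
            (![((0, σ), 0), ((0, σ), 1)] : Fin 2 → SectorLeg 1) x‖ ≤ cSs * U * ((4 : ℝ) ^ m) ^ s))
    (hSEp : ∀ l ≤ 4, ∀ (σ : Fin 2) (x₀ : SpaceTimeIdx L M),
      (imagTimeWeight β M * ∑ x ∈ (univ : Finset (Fin 2 → SpaceTimeIdx L M)).filter (fun x => x 0 = x₀),
        (1 + ((((x 1).2 - (x 0).2) 0).valMinAbs.natAbs : ℝ) + ((((x 1).2 - (x 0).2) 1).valMinAbs.natAbs : ℝ)) ^ l *
          ‖sectorisedKernel L M β (trivialMultiplier L M)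
            (effAction ℂ (normalCovariance L M (fun ks => uvSymbolCT L M β μ (klFlowFrameU L M β U μ (m + 1)) (klScale klE0 m) ks / (1 + uvSymbolCT L M β μ (klFlowFrameU L M β U μ (m + 1)) (klScale klE0 m) ks * (((fsub (klFlowFrameU L M β U μ (m + 1)) (klFlowFrameU L M β U μ m)).eval (latticeMomentum L ks.1.2) / (β * (L : ℝ) ^ 2) : ℝ) : ℂ)))) (hubbardInteraction L M β U + counterQuadratic L M β (klFlowFrameU L M β U μ m))) 2
            (![((0, σ), 0), ((0, σ), 1)] : Fin 2 → SectorLeg 1) x‖ ≤ cE l * U * ((4 : ℝ) ^ m) ^ l))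
    (hSEs : ∀ (σ : Fin 2) (x₀ : SpaceTimeIdx L M),
      (imagTimeWeight β M * ∑ x ∈ (univ : Finset (Fin 2 → SpaceTimeIdx L M)).filter (fun x => x 0 = x₀),
        (1 + ((((x 1).2 - (x 0).2) 0).valMinAbs.natAbs : ℝ) + ((((x 1).2 - (x 0).2) 1).valMinAbs.natAbs : ℝ)) ^ s *
          ‖sectorisedKernel L M β (trivialMultiplier L M)
            (effAction ℂ (normalCovariance L M (fun ks => uvSymbolCT L M β μ (klFlowFrameU L M β U μ (m + 1)) (klScale klE0 m) ks / (1 + uvSymbolCT L M β μ (klFlowFrameU L M β U μ (m + 1)) (klScale klE0 m) ks * (((fsub (klFlowFrameU L M β U μ (m + 1)) (klFlowFrameU L M β U μ m)).eval (latticeMomentum L ks.1.2) / (β * (L : ℝ) ^ 2) : ℝ) : ℂ)))) (hubbardInteraction L M β U + counterQuadratic L M β (klFlowFrameU L M β U μ m))) 2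
            (![((0, σ), 0), ((0, σ), 1)] : Fin 2 → SectorLeg 1) x‖ ≤ cEs * U * ((4 : ℝ) ^ m) ^ s))
    -- the (B) budget word
    {μc : ℕ → ℝ} (hμc0 : ∀ l, 0 ≤ μc l)
    (hμcv : 2 ^ 32 / 4 ^ 0 * R.Gfr 0 * cN 0 + (klEngRsq R ^ 4 * (cS 0 ^ 2 + cE 0 + 1) + (cSs ^ 2 + cEs + 1)) / 2 ^ 200 ≤ μc 0)
    (hμc : ∀ l, 1 ≤ l → l ≤ 4 → U * (2 ^ 32 / 4 ^ l * R.Gfr 0 * cN l + (klEngRsq R ^ 4 * (cS l ^ 2 + cE l + 1) + (cSs ^ 2 + cEs + 1)) / 2 ^ 200) ≤ μc l) :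
    ContDiff ℝ 4 (fun θ : ℝ =>
      (symInterp L (fun k => klLocSelfEnergyRe L M β U μ (klFlowFrameU L M β U μ (m + 1)) m k -
            (klFlowFrameU L M β U μ (m + 1)).eval (latticeMomentum L k))).eval (klFermiPoint μ (klFlowFrameU L M β U μ (m + 1)) θ) -
        (symInterp L (fun k => klLocSelfEnergyRe L M β U μ (klFlowFrameU L M β U μ m) m k -
            (klFlowFrameU L M β U μ m).eval (latticeMomentum L k))).eval (klFermiPoint μ (klFlowFrameU L M β U μ (m + 1)) θ)) ∧
    ∀ k ≤ 4, ∀ θ : ℝ, |iteratedDeriv k (fun θ : ℝ =>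
      (symInterp L (fun k => klLocSelfEnergyRe L M β U μ (klFlowFrameU L M β U μ (m + 1)) m k -
            (klFlowFrameU L M β U μ (m + 1)).eval (latticeMomentum L k))).eval (klFermiPoint μ (klFlowFrameU L M β U μ (m + 1)) θ) -
        (symInterp L (fun k => klLocSelfEnergyRe L M β U μ (klFlowFrameU L M β U μ m) m k -
            (klFlowFrameU L M β U μ m).eval (latticeMomentum L k))).eval (klFermiPoint μ (klFlowFrameU L M β U μ (m + 1)) θ)) θ| ≤
      curveJetBar (fun k => if k = 0 then 0 else readJetC μc k) (fun k => if k = 0 then μc 0 else readJetC' R μc k) U k (m + 1) := by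
  have hβ0 : 0 < β := pos_of_klBetaMin_le hβmin
  have hNβ : N ≤ nScales β := hNn.trans hm1
  have hmβ : m ≤ nScales β + 1 := by omega
  -- the envelope door gives `Gfr₀|U| ≤ 1/128`, hence the frame rate is below `Λ_m/4`
  have hW0 : 0 ≤ W := by
    rw [hW]
    exact add_nonneg (curveExtC_nonneg (by norm_num) hGS 1) (mul_nonneg (curveExtC_nonneg (by norm_num) hQS 1) (abs_nonneg U))
  have hG128 := gfr0_abs_le_of_hdoor hR hW0 hdoor
  have hPm : ∀ m' < m + 1, FlowPieceJetsAt L M β U μ R m' := fun m' hm' => hP m' (by omega)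
  have hfdist := frameDist_klFlowFrameU_succ_le (L := L) (M := M) (β := β) (U := U) (μ := μ) (R := R) (j := m) hPm
  have hfd := fd_le_klScale_div_four (hR 0) hG128 m
  -- the curve of the new flow frame: its points are ON the new curve and within the frame distance of the old one
  have hK' : FrameOK R U (nScales β) μ (klFlowFrameU L M β U μ (m + 1)) := FrameOK.mono hR hNβ hOK₂
  obtain ⟨hAf, -, -, -, ⟨hlo, hhi⟩, -, -⟩ := frame_sizes_of_frameOK_explicit hR hc hcle hU hUle hβmin hβc hμ hK'
  have hcurve : ∀ θ : ℝ, frameLevel μ (klFlowFrameU L M β U μ (m + 1)) (WithLp.toLp 2 (klFermiPoint μ (klFlowFrameU L M β U μ (m + 1)) θ)) = 0 :=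
    fun θ => frameLevel_klFermiPoint (bandBounds (show (-4 : ℝ) < -1.1 by norm_num) (show (-1.1 : ℝ) ≤ -0.1 by norm_num) (show (-0.1 : ℝ) < 0 by norm_num))
      hAf hlo hhi θ
  have hold : ∀ θ : ℝ, |frameLevel μ (klFlowFrameU L M β U μ m) (WithLp.toLp 2 (klFermiPoint μ (klFlowFrameU L M β U μ (m + 1)) θ))| ≤ klScale klE0 m / 4 := by
    intro θ
    have e : frameLevel μ (klFlowFrameU L M β U μ m) (WithLp.toLp 2 (klFermiPoint μ (klFlowFrameU L M β U μ (m + 1)) θ)) =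
        (klFlowFrameU L M β U μ (m + 1)).eval (klFermiPoint μ (klFlowFrameU L M β U μ (m + 1)) θ) -
          (klFlowFrameU L M β U μ m).eval (klFermiPoint μ (klFlowFrameU L M β U μ (m + 1)) θ) := by
      have h := hcurve θ
      simp only [frameLevel] at h ⊢
      linarith
    rw [e]
    exact ((abs_eval_sub_le_frameDist _ _ _).trans hfdist).trans hfd
  have hq : ∀ θ : ℝ,
      ((Real.pi / β) ^ 2 + frameLevel μ (klFlowFrameU L M β U μ (m + 1)) (WithLp.toLp 2 (klFermiPoint μ (klFlowFrameU L M β U μ (m + 1)) θ)) ^ 2 <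
          (klScale klE0 m) ^ 2 / 4) ∧
        ((Real.pi / β) ^ 2 + frameLevel μ (klFlowFrameU L M β U μ m) (WithLp.toLp 2 (klFermiPoint μ (klFlowFrameU L M β U μ (m + 1)) θ)) ^ 2 <
          (klScale klE0 m) ^ 2 / 4) :=
    fun θ => readingPoint_below_shells_of_succ_le_nScales hβmin hm1 (hcurve θ) (hold θ)
  -- the frame rate in the arithmetic word's currency
  have hfd0 : 0 ≤ R.Gfr 0 * uPow 0 U * (4 : ℝ) ^ ((((0 : ℕ) : ℤ) - 2) * (m : ℤ)) :=
    mul_nonneg (mul_nonneg (hR 0) (uPow_nonneg 0 U)) (zpow_nonneg (by norm_num) _)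
  have hfdlaw : R.Gfr 0 * uPow 0 U * (4 : ℝ) ^ ((((0 : ℕ) : ℤ) - 2) * (m : ℤ)) ≤ R.Gfr 0 * U * (((4 : ℝ) ^ m) ^ 2)⁻¹ := by
    rw [uPow_zero, abs_of_pos hU, fd_zpow_eq]
  -- per order: the pure door, then the arithmetic word, then the budget word
  have hz : ∀ l : ℕ, 0 ≤ U ^ 2 * (4 : ℝ) ^ (((l : ℤ) - 2) * ((m + 1 : ℕ) : ℤ)) := fun l => mul_nonneg (sq_nonneg U) (zpow_nonneg (by norm_num) _)
  -- order 0: law `cN 0·U`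
  have hrow0 : ∀ θ : ℝ, ‖iteratedFDeriv ℝ 0 (evalM (symInterp L (fun kv : TorusSite 2 L =>
        klLocSelfEnergyRe L M β U μ (klFlowFrameU L M β U μ (m + 1)) m kv - klLocSelfEnergyRe L M β U μ (klFlowFrameU L M β U μ m) m kv - (fsub (klFlowFrameU L M β U μ (m + 1)) (klFlowFrameU L M β U μ m)).eval (latticeMomentum L kv))))
      (WithLp.toLp 2 (klFermiPoint μ (klFlowFrameU L M β U μ (m + 1)) θ))‖ ≤ μc 0 * U ^ 2 * (4 : ℝ) ^ ((((0 : ℕ) : ℤ) - 2) * ((m + 1 : ℕ) : ℤ)) := by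
    intro θ
    have hcNl := hcN 0; have hcSl := hcS 0; have hcEl := hcE 0
    have hNp00 : 0 ≤ cN 0 * U := by positivity
    have hd := norm_iteratedFDeriv_klLocSelfEnergyRe_flowFrame_sub_le_main_add_alias_pos_pure hβmin hU hU1 μ m hR hGS hQS hμ hOK₁ hOK₂ hfdist hfd hZ₂ hZ 0
      (WithLp.toLp 2 (klFermiPoint μ (klFlowFrameU L M β U μ (m + 1)) θ)) hNp00 hNp0 (hq θ).1 (hq θ).2 hs (by norm_num)
      (Spj := cS 0 * U * ((4 : ℝ) ^ m) ^ 0) (Sps := cSs * U * ((4 : ℝ) ^ m) ^ s) (SEj := cE 0 * U * ((4 : ℝ) ^ m) ^ 0) (SEs := cEs * U * ((4 : ℝ) ^ m) ^ s)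
      (Nj := cS 0 * U * ((4 : ℝ) ^ m) ^ 0) (Ns := cSs * U) (Nj' := 2 * (cE 0 * U * ((4 : ℝ) ^ m) ^ 0)) (Ns' := 2 * (cEs * U))
      (fun t ht σ x₀ => ⟨hSp 0 (by norm_num) t ht σ x₀, hSps t ht σ x₀⟩) (fun σ x₀ => ⟨hSEp 0 (by norm_num) σ x₀, hSEs σ x₀⟩)
      hP hTJ hmn hR0 hW hΞ hΘ hdoor hL hmβ le_rfl le_rfl le_rfl (le_of_eq (by ring))
    have hlaw : cN 0 * U ≤ cN 0 * U * ((4 : ℝ) ^ m) ^ 0 := by rw [pow_zero, mul_one]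
    have ha := generalRHS_le_fit P R (l := 0) hβmin hm1 hU hU1 hL (by norm_num) hfd0 hfdlaw (hR 0) hNp00 hlaw (by positivity) le_rfl le_rfl
      (by positivity) le_rfl le_rfl hcNl hcSl hcEl hcSs hcEs
    calc _ ≤ _ := hd
      _ ≤ _ := ha
      _ ≤ μc 0 * (U ^ 2 * (4 : ℝ) ^ ((((0 : ℕ) : ℤ) - 2) * ((m + 1 : ℕ) : ℤ))) := mul_le_mul_of_nonneg_right hμcv (hz 0)
      _ = μc 0 * U ^ 2 * (4 : ℝ) ^ ((((0 : ℕ) : ℤ) - 2) * ((m + 1 : ℕ) : ℤ)) := by ring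
  -- orders 1 … 4: law `cN l·U²·(4^m)ˡ`, rows `|U|`-suppressed
  have hrow : ∀ l, 1 ≤ l → l ≤ 4 → ∀ θ : ℝ, ‖iteratedFDeriv ℝ l (evalM (symInterp L (fun kv : TorusSite 2 L =>
        klLocSelfEnergyRe L M β U μ (klFlowFrameU L M β U μ (m + 1)) m kv - klLocSelfEnergyRe L M β U μ (klFlowFrameU L M β U μ m) m kv - (fsub (klFlowFrameU L M β U μ (m + 1)) (klFlowFrameU L M β U μ m)).eval (latticeMomentum L kv))))
      (WithLp.toLp 2 (klFermiPoint μ (klFlowFrameU L M β U μ (m + 1)) θ))‖ ≤ μc l * U ^ 2 * (4 : ℝ) ^ (((l : ℤ) - 2) * ((m + 1 : ℕ) : ℤ)) := by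
    intro l hl1 hl θ
    have hcNl := hcN l; have hcSl := hcS l; have hcEl := hcE l
    have hNpl0 : 0 ≤ cN l * U ^ 2 * ((4 : ℝ) ^ m) ^ l := by positivity
    have hd := norm_iteratedFDeriv_klLocSelfEnergyRe_flowFrame_sub_le_main_add_alias_pos_pure hβmin hU hU1 μ m hR hGS hQS hμ hOK₁ hOK₂ hfdist hfd hZ₂ hZ l
      (WithLp.toLp 2 (klFermiPoint μ (klFlowFrameU L M β U μ (m + 1)) θ)) hNpl0 (hNp l hl1 hl) (hq θ).1 (hq θ).2 hs hl
      (Spj := cS l * U * ((4 : ℝ) ^ m) ^ l) (Sps := cSs * U * ((4 : ℝ) ^ m) ^ s) (SEj := cE l * U * ((4 : ℝ) ^ m) ^ l) (SEs := cEs * U * ((4 : ℝ) ^ m) ^ s)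
      (Nj := cS l * U * ((4 : ℝ) ^ m) ^ l) (Ns := cSs * U) (Nj' := 2 * (cE l * U * ((4 : ℝ) ^ m) ^ l)) (Ns' := 2 * (cEs * U))
      (fun t ht σ x₀ => ⟨hSp l hl t ht σ x₀, hSps t ht σ x₀⟩) (fun σ x₀ => ⟨hSEp l hl σ x₀, hSEs σ x₀⟩)
      hP hTJ hmn hR0 hW hΞ hΘ hdoor hL hmβ le_rfl le_rfl le_rfl (le_of_eq (by ring))
    have ha := generalRHS_le_fit_pure P R (l := l) hβmin hm1 hU hU1 hL hl hfd0 hfdlaw (hR 0) hNpl0 le_rfl (by positivity) le_rfl le_rfl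
      (by positivity) le_rfl le_rfl hcNl hcSl hcEl hcSs hcEs
    calc _ ≤ _ := hd
      _ ≤ _ := ha
      _ = U * (2 ^ 32 / 4 ^ l * R.Gfr 0 * cN l + (klEngRsq R ^ 4 * (cS l ^ 2 + cE l + 1) + (cSs ^ 2 + cEs + 1)) / 2 ^ 200) *
            (U ^ 2 * (4 : ℝ) ^ (((l : ℤ) - 2) * ((m + 1 : ℕ) : ℤ))) := by ring
      _ ≤ μc l * (U ^ 2 * (4 : ℝ) ^ (((l : ℤ) - 2) * ((m + 1 : ℕ) : ℤ))) := mul_le_mul_of_nonneg_right (hμc l hl1 hl) (hz l)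
      _ = μc l * U ^ 2 * (4 : ℝ) ^ (((l : ℤ) - 2) * ((m + 1 : ℕ) : ℤ)) := by ring
  refine frameResponse_hB_of_symbolSizes hR hc hcle hU hUle hU1 hβmin hβc hμ hOK₂ hNn hNβ hμc0 (fun θ => ?_) (fun θ l hl1 hl4 => hrow l hl1 hl4 θ)
  have h := hrow0 θ
  rwa [norm_iteratedFDeriv_zero, Real.norm_eq_abs] at h

end GeneralOfPosPure

end Summit.HubbardSuperconductivity.HubbardSuperconductivity.Theorems.EngineV8

end
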